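import Summits.QuantumFields.YangMills.Theorems.MirrorModularBoostsPlanarSpectralConeTransfer
import Summits.QuantumFields.YangMills.Theorems.MirrorModularBoostsCurvatureBoostCovarianceOrbitGluing
import Summits.QuantumFields.YangMills.Theorems.NPointIsotropy.Negative.HyperoctahedralPlane
import Literature.Analysis.Complex.SeparatelyHolomorphicStrips

/-!
# The operator cone family `e^{-ζH + iβP₁}` — stub `stub_operatorConeFamily`

Line `boosts-inherit-mirrors` of crux `MirrorModularBoosts.CurvatureBoostCovariance`
(stmt-QuantumFields-9663), Stub 4a-iii of the registered skeleton
`Cruxes/CurvatureBoostCovariance/Lines/boosts_inherit_mirrors.lean` (continuation lead c1, reshape 7):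
groundwork for the analytic input Stub 4a-ii (`stub_doubledOrbitKernel`, the doubled orbit kernel), landed
so that its attacker can compose SLOT OPERATORS instead of matrix elements.

Statement (`stub_operatorConeFamily`; abstract, pure bounded functional analysis).  Let `T` be a labelled
Schwinger family on `ℝ⁴` with reflection positivity and translation invariance on `⁰𝒮`, `h` its
Osterwalder–Schrader reconstruction without rotations (`OSReconstructionNoE1`: Hilbert space `h.Hilbert`,
`e^{-tH} = h.transfer t`, `U(a⃗) = h.translate a`, joint spectral measures `h.IsJointSpectralMeasure`).
If every joint spectral measure of `(H, P⃗)` at every vector is carried by the closed planar cone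
`{p₀ ≥ |p₁|}` (the operator cone `H ≥ |P₁|`), then there is ONE family of bounded operators `W(w)`,
`w = (ζ, β)` in the open tube `D = {|Im β| < Re ζ}`, with `‖W(w)‖ ≤ 1`, every matrix element
`w ↦ ⟪ψ, W(w) ψ'⟫` holomorphic on `D`, and `W(t, b) = e^{-tH} U(b e₁)` at the real points `t > 0`,
`b ∈ ℝ` — the operators `e^{-ζH + iβP₁}` without an unbounded functional calculus.

Proof.  The landed matrix-element family
`PositivityDiscToOperatorCone.Contraction.contractionFamily` (crux `PlanarSpectralCone`, file
`MirrorModularBoostsPlanarSpectralConeTransfer.lean`) gives for every pair `ψ, ψ'` a function `Φ_{ψ,ψ'}`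
holomorphic on `D` with `Φ_{ψ,ψ'}(t, b) = ⟪ψ, e^{-tH} U(b e₁) ψ'⟫` at the real points and
`|Φ_{ψ,ψ'}| ≤ ‖ψ‖ ‖ψ'‖` on `D`.  UNIQUENESS on `D` from the real points
(`OperatorConeFamily.eq_of_eq_on_real`: two one-variable identity theorems, with the landed
`OrbitBandlimit.tendsto_ofReal_nhdsGT` and `Literature.Analysis.Complex.isPreconnected_setOf_abs_im_lt` — in `ζ` on the right
half-plane at a real `β = b`, where the real half-line `t > 0` accumulates at `1`, then in `β` on the
horizontal strip `{|Im β| < Re ζ}` at fixed `ζ`, where the real line accumulates at `0`) makes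
`(ψ, ψ') ↦ Φ_{ψ,ψ'}(w)` SESQUILINEAR for each `w ∈ D` (both sides of each linearity identity are
holomorphic on `D` and agree at the real points, where they are inner products).  So for `w ∈ D` the map
`(ψ', ψ) ↦ conj Φ_{ψ,ψ'}(w)` is a bounded sesquilinear form of norm `≤ 1`
(`LinearMap.mk₂'ₛₗ` + `LinearMap.mkContinuous₂`), and the Riesz representation
`InnerProductSpace.continuousLinearMapOfBilin` turns it into an operator `W(w)` with
`⟪ψ, W(w) ψ'⟫ = Φ_{ψ,ψ'}(w)`, whence `‖W(w) ψ'‖² = Φ_{Wψ',ψ'}(w) ≤ ‖W(w)ψ'‖ ‖ψ'‖`, i.e. `‖W(w)‖ ≤ 1`.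
Holomorphy of the matrix elements is that of `Φ`; at a real point `⟪ψ, W ψ'⟫ = ⟪ψ, e^{-tH}U(be₁)ψ'⟫`
for all `ψ` identifies the vectors.  (The semigroup law and strong holomorphy follow by the same
uniqueness and are left to the consumer.)  No degenerate case is special (`D` does not meet `Re ζ ≤ 0`).

References: K. Osterwalder, R. Schrader, *Axioms for Euclidean Green's functions*, Comm. Math. Phys.
31 (1973), §4.1 (`e^{-tH}`, `U(a⃗)`); M. Reed, B. Simon, *Methods of Modern Mathematical Physics I*,
Thm. VIII.12 (joint spectral measures) and the Riesz lemma; the identity theorem is Mathlib's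
`AnalyticOnNhd.eqOn_zero_of_preconnected_of_frequently_eq_zero`.
-/

noncomputable section

namespace Summit.QuantumFields.YangMills.Theorems.CurvatureBoostCovariance.BoostsInheritMirrors

open scoped InnerProductSpace ComplexConjugate
open MeasureTheory Filter Topology
open Literature.MathematicalPhysics.QuantumLattice Literature.MathematicalPhysics.AQFT
  Literature.MathematicalPhysics.QuantumFieldTheory
open Summit.QuantumFields.YangMills.Theorems.NPointIsotropy.Negative (E4)

namespace OperatorConeFamily

/-! ## Uniqueness on the tube `{|Im β| < Re ζ}` from the real points -/

/-- **A holomorphic function on the tube vanishing at the real points `(t, b)`, `t > 0`, vanishes.**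
First in `ζ` on the right half-plane at real `β = b` (the zeros `t > 1` accumulate at `1`), then in
`β` on the strip `{|Im β| < Re ζ}` at fixed `ζ` (the real zeros accumulate at `0`). -/
theorem eq_zero_of_eq_zero_on_real {d : ℂ × ℂ → ℂ}
    (hd : DifferentiableOn ℂ d {w : ℂ × ℂ | |w.2.im| < w.1.re})
    (h0 : ∀ t b : ℝ, 0 < t → d ((t : ℂ), (b : ℂ)) = 0) :
    ∀ w ∈ {w : ℂ × ℂ | |w.2.im| < w.1.re}, d w = 0 := by
  -- Step 1: real second coordinate, any `ζ` in the right half-plane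
  have step1 : ∀ ζ : ℂ, 0 < ζ.re → ∀ b : ℝ, d (ζ, (b : ℂ)) = 0 := by
    intro ζ hζ b
    set U : Set ℂ := {z : ℂ | 0 < z.re} with hU
    have hUo : IsOpen U := isOpen_lt continuous_const Complex.continuous_re
    have hincl : Set.MapsTo (fun z : ℂ => (z, (b : ℂ))) U {w : ℂ × ℂ | |w.2.im| < w.1.re} := by
      intro z hz
      simpa [hU] using hz
    have hι : Differentiable ℂ fun z : ℂ => (z, (b : ℂ)) := differentiable_id.prodMk (differentiable_const _)
    have hs : DifferentiableOn ℂ (fun z : ℂ => d (z, (b : ℂ))) U := hd.comp hι.differentiableOn hincl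
    have hsa : AnalyticOnNhd ℂ (fun z : ℂ => d (z, (b : ℂ))) U := hs.analyticOnNhd hUo
    have hfreq : ∃ᶠ z in 𝓝[≠] ((1 : ℝ) : ℂ), d (z, (b : ℂ)) = 0 := by
      have hev : ∀ᶠ s : ℝ in 𝓝[>] (1 : ℝ), d ((s : ℂ), (b : ℂ)) = 0 := by
        filter_upwards [self_mem_nhdsWithin] with s hs
        exact h0 s b (lt_trans one_pos hs)
      exact (OrbitBandlimit.tendsto_ofReal_nhdsGT 1).frequently hev.frequently
    have h1U : ((1 : ℝ) : ℂ) ∈ U := by simp [hU]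
    have hzero := hsa.eqOn_zero_of_preconnected_of_frequently_eq_zero
      (convex_halfSpace_re_gt 0).isPreconnected h1U hfreq
    exact hzero (show ζ ∈ U from hζ)
  -- Step 2: fixed `ζ`, the strip in `β`
  rintro ⟨ζ, β⟩ hw'
  have hw : |β.im| < ζ.re := hw'
  have hζ : 0 < ζ.re := lt_of_le_of_lt (abs_nonneg _) hw
  set V : Set ℂ := {z : ℂ | |z.im| < ζ.re} with hV
  have hVo : IsOpen V := isOpen_lt (continuous_abs.comp Complex.continuous_im) continuous_const
  have hincl : Set.MapsTo (fun z : ℂ => (ζ, z)) V {w : ℂ × ℂ | |w.2.im| < w.1.re} := fun z hz => hz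
  have hι : Differentiable ℂ fun z : ℂ => (ζ, z) := (differentiable_const _).prodMk differentiable_id
  have hs : DifferentiableOn ℂ (fun z : ℂ => d (ζ, z)) V := hd.comp hι.differentiableOn hincl
  have hsa : AnalyticOnNhd ℂ (fun z : ℂ => d (ζ, z)) V := hs.analyticOnNhd hVo
  have hfreq : ∃ᶠ z in 𝓝[≠] ((0 : ℝ) : ℂ), d (ζ, z) = 0 := by
    have hev : ∀ᶠ s : ℝ in 𝓝[>] (0 : ℝ), d (ζ, (s : ℂ)) = 0 := by
      filter_upwards [self_mem_nhdsWithin] with s _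
      exact step1 ζ hζ s
    exact (OrbitBandlimit.tendsto_ofReal_nhdsGT 0).frequently hev.frequently
  have h0V : ((0 : ℝ) : ℂ) ∈ V := by simp [hV, hζ]
  have hzero := hsa.eqOn_zero_of_preconnected_of_frequently_eq_zero (Literature.Analysis.Complex.isPreconnected_setOf_abs_im_lt _) h0V hfreq
  exact hzero (show β ∈ V from hw)

/-- **Uniqueness on the tube**: two holomorphic functions on `{|Im β| < Re ζ}` that agree at the real
points `(t, b)`, `t > 0`, agree. -/
theorem eq_of_eq_on_real {f g : ℂ × ℂ → ℂ}
    (hf : DifferentiableOn ℂ f {w : ℂ × ℂ | |w.2.im| < w.1.re})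
    (hg : DifferentiableOn ℂ g {w : ℂ × ℂ | |w.2.im| < w.1.re})
    (hfg : ∀ t b : ℝ, 0 < t → f ((t : ℂ), (b : ℂ)) = g ((t : ℂ), (b : ℂ))) :
    ∀ w ∈ {w : ℂ × ℂ | |w.2.im| < w.1.re}, f w = g w := by
  intro w hw
  have := eq_zero_of_eq_zero_on_real (hf.sub hg) (fun t b ht => by
    rw [Pi.sub_apply, hfg t b ht, sub_self]) w hw
  exact sub_eq_zero.1 this

/-- Real points `(t, b)`, `t > 0`, lie in the tube. -/
theorem ofReal_mem_tube {t : ℝ} (ht : 0 < t) (b : ℝ) :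
    ((t : ℂ), (b : ℂ)) ∈ {w : ℂ × ℂ | |w.2.im| < w.1.re} := by
  simp [ht]

/-! ## From a bounded sesquilinear family to contractions -/

/-- **Riesz for one point of the tube.**  A function `Φ : H → H → ℂ`, conjugate-linear in the first
and linear in the second variable, with `|Φ ψ ψ'| ≤ ‖ψ‖ ‖ψ'‖`, is the matrix element `⟪ψ, A ψ'⟫` of a
contraction `A`. -/
theorem exists_contraction_of_sesq {H : Type*} [NormedAddCommGroup H] [InnerProductSpace ℂ H]
    [CompleteSpace H] (Φ : H → H → ℂ)
    (hadd₁ : ∀ ψ₁ ψ₂ ψ', Φ (ψ₁ + ψ₂) ψ' = Φ ψ₁ ψ' + Φ ψ₂ ψ')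
    (hsmul₁ : ∀ (c : ℂ) ψ ψ', Φ (c • ψ) ψ' = conj c * Φ ψ ψ')
    (hadd₂ : ∀ ψ ψ₁' ψ₂', Φ ψ (ψ₁' + ψ₂') = Φ ψ ψ₁' + Φ ψ ψ₂')
    (hsmul₂ : ∀ (c : ℂ) ψ ψ', Φ ψ (c • ψ') = c * Φ ψ ψ')
    (hbd : ∀ ψ ψ', ‖Φ ψ ψ'‖ ≤ ‖ψ‖ * ‖ψ'‖) :
    ∃ A : H →L[ℂ] H, ‖A‖ ≤ 1 ∧ ∀ ψ ψ', ⟪ψ, A ψ'⟫_ℂ = Φ ψ ψ' := by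
  -- the bounded sesquilinear form `(ψ', ψ) ↦ conj (Φ ψ ψ')`
  let B₀ : H →ₗ⋆[ℂ] H →ₗ[ℂ] ℂ :=
    LinearMap.mk₂'ₛₗ (starRingEnd ℂ) (RingHom.id ℂ) (fun ψ' ψ => conj (Φ ψ ψ'))
      (fun ψ₁' ψ₂' ψ => by simp only [hadd₂, map_add])
      (fun c ψ' ψ => by simp only [hsmul₂, map_mul, smul_eq_mul])
      (fun ψ' ψ₁ ψ₂ => by simp only [hadd₁, map_add])
      (fun c ψ' ψ => by simp only [hsmul₁, map_mul, Complex.conj_conj, RingHom.id_apply, smul_eq_mul])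
  have hB₀ : ∀ ψ' ψ, ‖B₀ ψ' ψ‖ ≤ 1 * ‖ψ'‖ * ‖ψ‖ := fun ψ' ψ => by
    change ‖conj (Φ ψ ψ')‖ ≤ 1 * ‖ψ'‖ * ‖ψ‖
    rw [Complex.norm_conj, one_mul, mul_comm]
    exact hbd ψ ψ'
  let B : H →L⋆[ℂ] H →L[ℂ] ℂ := B₀.mkContinuous₂ 1 hB₀
  have hBapply : ∀ ψ' ψ, B ψ' ψ = conj (Φ ψ ψ') := fun _ _ => rfl
  -- its Riesz operator
  let A : H →L[ℂ] H := InnerProductSpace.continuousLinearMapOfBilin B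
  have hA : ∀ ψ ψ', ⟪ψ, A ψ'⟫_ℂ = Φ ψ ψ' := fun ψ ψ' => by
    rw [← inner_conj_symm, InnerProductSpace.continuousLinearMapOfBilin_apply, hBapply,
      Complex.conj_conj]
  refine ⟨A, ?_, hA⟩
  refine ContinuousLinearMap.opNorm_le_bound _ zero_le_one fun ψ' => ?_
  rw [one_mul]
  have hsq : ‖A ψ'‖ * ‖A ψ'‖ ≤ ‖A ψ'‖ * ‖ψ'‖ := by
    have h1 : (‖A ψ'‖ : ℝ) ^ 2 = (⟪A ψ', A ψ'⟫_ℂ).re := by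
      rw [← inner_self_eq_norm_sq (𝕜 := ℂ) (A ψ')]; rfl
    calc ‖A ψ'‖ * ‖A ψ'‖ = ‖A ψ'‖ ^ 2 := (sq _).symm
      _ = (Φ (A ψ') ψ').re := by rw [h1, hA]
      _ ≤ ‖Φ (A ψ') ψ'‖ := Complex.re_le_norm _
      _ ≤ ‖A ψ'‖ * ‖ψ'‖ := hbd _ _
  by_cases hz : A ψ' = 0
  · simp [hz]
  · exact le_of_mul_le_mul_left hsq (norm_pos_iff.2 hz)

end OperatorConeFamily

open OperatorConeFamily in
/-- **Stub 4a-iii — THE OPERATOR CONE FAMILY `e^{-ζH + iβP₁}`** (registered statement of the skeleton,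
line `boosts-inherit-mirrors`, reshape 7).  If every joint spectral measure of `(H, P⃗)` of the
`e₀`-reconstruction `h` of a labelled family `T` on `ℝ⁴` (E2 + translations) is carried by the closed planar
cone `{p₀ ≥ |p₁|}`, then there is a family of contractions `W(w)` on the tube `{|Im β| < Re ζ}` with
holomorphic matrix elements and `W(t, b) = e^{-tH} U(b e₁)` at the real points `t > 0`. -/
theorem stub_operatorConeFamily :
    open Literature.MathematicalPhysics.QuantumLattice Literature.MathematicalPhysics.AQFT
      Literature.MathematicalPhysics.QuantumFieldTheory
      Summit.QuantumFields.YangMills.Theorems.NPointIsotropy.Negative in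
    ∀ (ι : Type) (T : LabelledSchwingerFamily ι E4) (h : OSReconstructionNoE1 T),
      (∀ (ψ : h.Hilbert) (μ : MeasureTheory.Measure E4), h.IsJointSpectralMeasure ψ μ →
        μ {p : E4 | p 0 < |p 1|} = 0) →
      ∃ W : ℂ × ℂ → (h.Hilbert →L[ℂ] h.Hilbert),
        (∀ ψ ψ' : h.Hilbert,
          DifferentiableOn ℂ (fun w : ℂ × ℂ => ⟪ψ, W w ψ'⟫_ℂ) {w : ℂ × ℂ | |w.2.im| < w.1.re}) ∧
        (∀ w : ℂ × ℂ, |w.2.im| < w.1.re → ‖W w‖ ≤ 1) ∧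
        ∀ (t b : ℝ), 0 < t → ∀ ψ' : h.Hilbert,
          W ((t : ℂ), (b : ℂ)) ψ' = h.transfer t (h.translate (b • EuclideanSpace.single 1 1) ψ') := by
  classical
  intro ι T h hcone
  -- the landed matrix-element family
  choose Φ hΦd hΦr hΦb using fun ψ ψ' : h.Hilbert =>
    Summit.QuantumFields.YangMills.Cruxes.PlanarSpectralCone.PositivityDiscToOperatorCone.Contraction.contractionFamily
      h hcone ψ ψ'
  set D : Set (ℂ × ℂ) := {w : ℂ × ℂ | |w.2.im| < w.1.re} with hD
  -- the real-point vectors are linear in `ψ'`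
  have hVadd : ∀ (t b : ℝ) (ψ₁' ψ₂' : h.Hilbert),
      h.transfer t (h.translate (b • EuclideanSpace.single 1 1) (ψ₁' + ψ₂')) =
        h.transfer t (h.translate (b • EuclideanSpace.single 1 1) ψ₁') +
          h.transfer t (h.translate (b • EuclideanSpace.single 1 1) ψ₂') := by
    intro t b ψ₁' ψ₂'; rw [map_add, map_add]
  have hVsmul : ∀ (t b : ℝ) (c : ℂ) (ψ' : h.Hilbert),
      h.transfer t (h.translate (b • EuclideanSpace.single 1 1) (c • ψ')) =
        c • h.transfer t (h.translate (b • EuclideanSpace.single 1 1) ψ') := by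
    intro t b c ψ'; rw [map_smul, map_smul]
  -- sesquilinearity of `Φ · · w` on `D`, by uniqueness from the real points
  have hadd₂ : ∀ ψ ψ₁' ψ₂', ∀ w ∈ D, Φ ψ (ψ₁' + ψ₂') w = Φ ψ ψ₁' w + Φ ψ ψ₂' w := by
    intro ψ ψ₁' ψ₂'
    refine eq_of_eq_on_real (hΦd ψ _) ((hΦd ψ ψ₁').add (hΦd ψ ψ₂')) fun t b ht => ?_
    simp only [hΦr _ _ t b ht, hVadd, inner_add_right]
  have hsmul₂ : ∀ (c : ℂ) ψ ψ', ∀ w ∈ D, Φ ψ (c • ψ') w = c * Φ ψ ψ' w := by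
    intro c ψ ψ'
    refine eq_of_eq_on_real (hΦd ψ _) ((hΦd ψ ψ').const_mul c) fun t b ht => ?_
    simp only [hΦr _ _ t b ht, hVsmul, inner_smul_right]
  have hadd₁ : ∀ ψ₁ ψ₂ ψ', ∀ w ∈ D, Φ (ψ₁ + ψ₂) ψ' w = Φ ψ₁ ψ' w + Φ ψ₂ ψ' w := by
    intro ψ₁ ψ₂ ψ'
    refine eq_of_eq_on_real (hΦd _ ψ') ((hΦd ψ₁ ψ').add (hΦd ψ₂ ψ')) fun t b ht => ?_
    simp only [hΦr _ _ t b ht, inner_add_left]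
  have hsmul₁ : ∀ (c : ℂ) ψ ψ', ∀ w ∈ D, Φ (c • ψ) ψ' w = conj c * Φ ψ ψ' w := by
    intro c ψ ψ'
    refine eq_of_eq_on_real (hΦd _ ψ') ((hΦd ψ ψ').const_mul (conj c)) fun t b ht => ?_
    simp only [hΦr _ _ t b ht, inner_smul_left]
  -- the contraction at every point of the tube
  have key : ∀ w ∈ D, ∃ A : h.Hilbert →L[ℂ] h.Hilbert, ‖A‖ ≤ 1 ∧ ∀ ψ ψ', ⟪ψ, A ψ'⟫_ℂ = Φ ψ ψ' w := by
    intro w hw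
    exact exists_contraction_of_sesq (fun ψ ψ' => Φ ψ ψ' w) (fun ψ₁ ψ₂ ψ' => hadd₁ ψ₁ ψ₂ ψ' w hw)
      (fun c ψ ψ' => hsmul₁ c ψ ψ' w hw) (fun ψ ψ₁' ψ₂' => hadd₂ ψ ψ₁' ψ₂' w hw)
      (fun c ψ ψ' => hsmul₂ c ψ ψ' w hw) (fun ψ ψ' => hΦb ψ ψ' w hw)
  choose! W hWn hWΦ using key
  refine ⟨W, fun ψ ψ' => ?_, fun w hw => hWn w hw, fun t b ht ψ' => ?_⟩
  · exact (hΦd ψ ψ').congr fun w hw => hWΦ w hw ψ ψ'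
  · refine ext_inner_left ℂ fun ψ => ?_
    rw [hWΦ _ (ofReal_mem_tube ht b) ψ ψ', hΦr ψ ψ' t b ht]


namespace OperatorConeFamily

/-! ## Algebra of an operator cone family: the semigroup law and commutation with the translations

Appended by the continuation lead c1 (cycle 2 of line `boosts-inherit-mirrors`, groundwork R1b for Stub 4a-ii): for ANY
family `W` with holomorphic matrix elements on the tube `{|Im β| < Re ζ}` and `W(t, b) = e^{-tH} U(b e₁)` at the real
points (the conclusion of `stub_operatorConeFamily`), uniqueness on the tube (`eq_of_eq_on_real`) gives the SEMIGROUP LAW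
`W(w + w') = W(w) W(w')` (two nested uniqueness arguments: first in `w'` at a real `w = (t, b)`, moving `e^{-tH} U(b e₁)`
to the bra, then in `w`) and the commutation of every `W(w)` with every spatial translation `U(a)` (in particular with the
transverse ones) — the slot calculus an attacker of `stub_doubledOrbitKernel` composes. -/

variable {ι : Type} {T : LabelledSchwingerFamily ι E4}

/-- The tube `{|Im β| < Re ζ}` is closed under addition. -/
theorem add_mem_tube {w w' : ℂ × ℂ} (hw : w ∈ {w : ℂ × ℂ | |w.2.im| < w.1.re})
    (hw' : w' ∈ {w : ℂ × ℂ | |w.2.im| < w.1.re}) :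
    w + w' ∈ {w : ℂ × ℂ | |w.2.im| < w.1.re} := by
  simp only [Set.mem_setOf_eq, Prod.fst_add, Prod.snd_add, Complex.add_re, Complex.add_im] at hw hw' ⊢
  exact (abs_add_le _ _).trans_lt (add_lt_add hw hw')

/-- `⟪U(a) φ, χ⟫ = ⟪φ, U(-a) χ⟫` (unitarity of the spatial translations). -/
theorem inner_translate_left (h : OSReconstructionNoE1 T) (a : E4) (φ χ : h.Hilbert) :
    ⟪h.translate a φ, χ⟫_ℂ = ⟪φ, h.translate (-a) χ⟫_ℂ := by
  have hχ : χ = h.translate a (h.translate (-a) χ) := by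
    rw [← h.translate_add_apply, add_neg_cancel, h.translate_zero_apply]
  conv_lhs => rw [hχ]
  exact (h.translate a).inner_map_map φ _

/-- Moving `e^{-tH} U(b e₁)` to the bra: `⟪ψ, e^{-tH} U(be₁) χ⟫ = ⟪U(-be₁) e^{-tH} ψ, χ⟫`. -/
theorem inner_transferTranslate_right (h : OSReconstructionNoE1 T) (t b : ℝ) (ψ χ : h.Hilbert) :
    ⟪ψ, h.transfer t (h.translate (b • EuclideanSpace.single 1 1) χ)⟫_ℂ =
      ⟪h.translate (-(b • EuclideanSpace.single 1 1)) (h.transfer t ψ), χ⟫_ℂ := by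
  rw [← h.inner_transfer_left, inner_translate_left, neg_neg]

/-- The real-point composition law `e^{-tH} U(be₁) e^{-t'H} U(b'e₁) = e^{-(t+t')H} U((b+b')e₁)`. -/
theorem transferTranslate_transferTranslate (h : OSReconstructionNoE1 T) {t t' : ℝ} (ht : 0 ≤ t) (ht' : 0 ≤ t')
    (b b' : ℝ) (χ : h.Hilbert) :
    h.transfer t (h.translate (b • EuclideanSpace.single 1 1)
      (h.transfer t' (h.translate (b' • EuclideanSpace.single 1 1) χ))) =
    h.transfer (t + t') (h.translate ((b + b') • EuclideanSpace.single 1 1) χ) := by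
  rw [h.translate_transfer, ← h.translate_add_apply, ← add_smul, h.transfer_add ht ht',
    ContinuousLinearMap.comp_apply]

/-- Real points add as real points. -/
theorem ofReal_add_ofReal (t t' b b' : ℝ) :
    (((t : ℂ), (b : ℂ)) : ℂ × ℂ) + ((t' : ℂ), (b' : ℂ)) = (((t + t' : ℝ) : ℂ), ((b + b' : ℝ) : ℂ)) := by
  ext <;> simp

/-- **Semigroup law, first half (uniqueness in `w'`)**: at a real point `w = (t, b)`,
`⟪ψ, W((t,b) + w') ψ'⟫ = ⟪U(-be₁) e^{-tH} ψ, W(w') ψ'⟫` for every `w'` in the tube. -/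
theorem inner_family_real_add (h : OSReconstructionNoE1 T) (W : ℂ × ℂ → (h.Hilbert →L[ℂ] h.Hilbert))
    (hhol : ∀ ψ ψ' : h.Hilbert,
      DifferentiableOn ℂ (fun w : ℂ × ℂ => ⟪ψ, W w ψ'⟫_ℂ) {w : ℂ × ℂ | |w.2.im| < w.1.re})
    (hreal : ∀ (t b : ℝ), 0 < t → ∀ ψ' : h.Hilbert,
      W ((t : ℂ), (b : ℂ)) ψ' = h.transfer t (h.translate (b • EuclideanSpace.single 1 1) ψ'))
    {t : ℝ} (ht : 0 < t) (b : ℝ) (ψ ψ' : h.Hilbert) :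
    ∀ w' ∈ {w : ℂ × ℂ | |w.2.im| < w.1.re},
      ⟪ψ, W (((t : ℂ), (b : ℂ)) + w') ψ'⟫_ℂ =
        ⟪h.translate (-(b • EuclideanSpace.single 1 1)) (h.transfer t ψ), W w' ψ'⟫_ℂ := by
  have hc : (((t : ℂ), (b : ℂ)) : ℂ × ℂ) ∈ {w : ℂ × ℂ | |w.2.im| < w.1.re} := ofReal_mem_tube ht b
  refine eq_of_eq_on_real ?_ (hhol _ ψ') fun t' b' ht' => ?_
  · have hι : Differentiable ℂ fun w' : ℂ × ℂ => (((t : ℂ), (b : ℂ)) : ℂ × ℂ) + w' :=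
      (differentiable_const _).add differentiable_id
    exact (hhol ψ ψ').comp hι.differentiableOn fun w' hw' => add_mem_tube hc hw'
  · rw [ofReal_add_ofReal, hreal _ _ (add_pos ht ht'), hreal _ _ ht',
      ← transferTranslate_transferTranslate h ht.le ht'.le, inner_transferTranslate_right]

/-- **THE SEMIGROUP LAW of an operator cone family**: `W(w + w') = W(w) W(w')` on the tube, for any family with
holomorphic matrix elements and the real-point values `e^{-tH} U(be₁)` (uniqueness in `w`, after
`inner_family_real_add`). -/
theorem family_add (h : OSReconstructionNoE1 T) (W : ℂ × ℂ → (h.Hilbert →L[ℂ] h.Hilbert))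
    (hhol : ∀ ψ ψ' : h.Hilbert,
      DifferentiableOn ℂ (fun w : ℂ × ℂ => ⟪ψ, W w ψ'⟫_ℂ) {w : ℂ × ℂ | |w.2.im| < w.1.re})
    (hreal : ∀ (t b : ℝ), 0 < t → ∀ ψ' : h.Hilbert,
      W ((t : ℂ), (b : ℂ)) ψ' = h.transfer t (h.translate (b • EuclideanSpace.single 1 1) ψ')) :
    ∀ w ∈ {w : ℂ × ℂ | |w.2.im| < w.1.re}, ∀ w' ∈ {w : ℂ × ℂ | |w.2.im| < w.1.re},
      W (w + w') = W w ∘L W w' := by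
  intro w hw w' hw'
  refine ContinuousLinearMap.ext fun ψ' => ext_inner_left ℂ fun ψ => ?_
  rw [ContinuousLinearMap.comp_apply]
  revert w hw
  refine eq_of_eq_on_real ?_ (hhol ψ (W w' ψ')) fun t b ht => ?_
  · have hι : Differentiable ℂ fun w : ℂ × ℂ => w + w' := differentiable_id.add (differentiable_const _)
    exact (hhol ψ ψ').comp hι.differentiableOn fun w hw => add_mem_tube hw hw'
  · rw [inner_family_real_add h W hhol hreal ht b ψ ψ' w' hw', hreal _ _ ht, inner_transferTranslate_right]

/-- **Commutation with the spatial translations**: `W(w) U(a) = U(a) W(w)` for every `a` (in particular for the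
transverse translations `a ⊥ e₀, e₁`), for any family as above. -/
theorem family_translate_comm (h : OSReconstructionNoE1 T) (W : ℂ × ℂ → (h.Hilbert →L[ℂ] h.Hilbert))
    (hhol : ∀ ψ ψ' : h.Hilbert,
      DifferentiableOn ℂ (fun w : ℂ × ℂ => ⟪ψ, W w ψ'⟫_ℂ) {w : ℂ × ℂ | |w.2.im| < w.1.re})
    (hreal : ∀ (t b : ℝ), 0 < t → ∀ ψ' : h.Hilbert,
      W ((t : ℂ), (b : ℂ)) ψ' = h.transfer t (h.translate (b • EuclideanSpace.single 1 1) ψ'))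
    (a : E4) :
    ∀ w ∈ {w : ℂ × ℂ | |w.2.im| < w.1.re}, ∀ ψ' : h.Hilbert,
      W w (h.translate a ψ') = h.translate a (W w ψ') := by
  have key : ∀ w ∈ {w : ℂ × ℂ | |w.2.im| < w.1.re}, ∀ ψ ψ' : h.Hilbert,
      ⟪ψ, W w (h.translate a ψ')⟫_ℂ = ⟪h.translate (-a) ψ, W w ψ'⟫_ℂ := by
    intro w hw ψ ψ'
    revert w hw
    refine eq_of_eq_on_real (hhol ψ _) (hhol _ ψ') fun t b ht => ?_
    rw [hreal _ _ ht, hreal _ _ ht, inner_translate_left, neg_neg, h.translate_transfer,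
      ← h.translate_add_apply, ← h.translate_add_apply, add_comm]
  intro w hw ψ'
  refine ext_inner_left ℂ fun ψ => ?_
  rw [key w hw, inner_translate_left, neg_neg]

end OperatorConeFamily

end Summit.QuantumFields.YangMills.Theorems.CurvatureBoostCovariance.BoostsInheritMirrors

end
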